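import Summits.AtomisticToContinuum.Crystallization.Theorems.OverbindingBudgetAffineCompressedCutBoxBounds

/-!
# Overbinding budget, R4 «LR(r₁)» part IX — STEP A: the hex-disc dichotomy at the base site, the Case A label arithmetic, the base patch

Route `OverbindingBudget`, crux `RobustDefectLimitWindows`, open leaf `NearFieldSlackMinSecond 12 (1/25)` ⟸ 79K ⟸ LR(r₁) (memos NODE-g80-LayerRigidity
§2, NODE-g81-Budget §3–§4).  This file is STEP A of the layer-rigidity reading at the record constants (`r = 12ν`, `ν = nn_i`, sequences `tauR`,
`dR` of «Budget»): it produces the BASE PATCH that «BoxBounds».`stack_run_box_record` climbs from, in one uniform shape for both cases.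

* §1 `fcc_disc_or_hcp` — the DICHOTOMY VARIANT of `…Seed.layer_disc` (tables KF, no forcing hypothesis `hQC`): growing the `(1,1,1)`-layer disc of an fcc
  base site `i` bond by bond, EITHER some child at hex depth `d′ ≤ n` is an hcp site (established, charted onto a member of `hcpFamilyL`, label a layer
  vector of `lnorm ≤ 6d′`, bounds `(τs d′, Ds d′)`, scale window `[0.9967^d′, 1.0011^d′]·ν`) — CASE A — OR every layer vector of hex radius `n` labels
  an established `F⁺`-charted site with bounds `(τs n, Ds n)` — CASE B.
* §2 Case A label arithmetic, CERTIFIED BY A FINITE TABLE (`caseA_table`, `decide` over the `8 × 13 × 13` sign/label cases; defs `lamA`/`levA`/`remA`): after the O8 flip `Φ_s` the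
  seed label `λ₀ = tflip s x′` (`x′` a layer vector of hex size `≤ d′ ≤ 6`) splits as `λ₀ = (2j,2j,2j) + w + x₀` with `thsum λ₀ = 6j` (the seed's LEVEL),
  `w = wOf j ∈ {0, ±(1,1,−2)}` (`w_c ≡ j (mod 3)`), `x₀` a layer vector, and the JOINT BUDGET `lnorm x₀ ≤ 6h₀`, `h₀ ≤ d′`, `h₀ + |j| ≤ d′ + 4`, `|j| ≤ d′`
  (`caseA_split`; the g81 memo's `lnorm x₀ ≤ 24` was wrong — `lnorm x₀ = 36` occurs — and is replaced by this joint inequality, which gives base depth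
  `d′ + 9 + h₀ ≤ 21` and total depth `d′ + 9 + h₀ + 5 + |j| ≤ 30 ≤ 31`).
* §3 `room_budget21` / `room_base_A21` — the Case A base room re-priced at `a + dm ≤ 21` (`(401/400)·10.838 + 0.166 ≤ 12`; a closed numeric lemma, NOT a
  run hypothesis), and `hcpL_mem_hcpFamilyL`.
* §4 ★ `base_patch_record` — THE BASE PATCH: from the record ball data at `i` (any type) there are a sign `s`, an aligned copy `C₀ ∈ {F⁺, F⁻, H, H′}`, a level
  `j` (`|j| ≤ 6`), an axis offset `w` (`|w_c| ≤ bw ≤ 2`, constant residue), a box size `K₀ ∈ {18, 27}` with the coverage inequality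
  `18 − |ℓ| + bw ≤ K₀ − |ℓ − j|` (`|ℓ| ≤ 5`), and a global step count `a` with `a + 5 + |j| ≤ 31`, such that in the flipped base frame `B = (ν•A_i) ∘ Φ_s`
  every layer vector `x` of the box `InBox 0 K₀` labels an established site at `(2j,2j,2j) + w + x`, copy `C₀`, bounds `(tauR ν a, dR ν a)`, window
  `[0.9967^a, 1.0011^a]·ν` — exactly the `hbase` of `stack_run_box_record` (Case B: `s = (1,1,1)`, `j = 0`, `w = 0`, `K₀ = 18`, `a = 6`; Case A: `K₀ = 27`).
-/

namespace Summit.AtomisticToContinuum.Crystallization.Theorems.OverbindingBudgetAffineCompressedCutStepA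

open Literature.Geometry.DiscreteGeometry (nearestDist nearestDist_nonneg fccTwoShellPattern hcpTwoShellPattern)
open Summit.AtomisticToContinuum.Crystallization.Theorems.OverbindingBudgetAffineCompressedCutKernel (T3 tsub tadd tsq thsum tflip fccL fccNegL hcpL
  hcpAltL hexL hcpFamilyL kernelOneB fccShellL kf_fcc kf_hcp toV)
open Summit.AtomisticToContinuum.Crystallization.Theorems.OverbindingBudgetAffineCompressedCutCharts (mv)
open Summit.AtomisticToContinuum.Crystallization.Theorems.OverbindingBudgetAffineCompressedCutEstablish (Estab estab_child_one tadd_tsub_cancel)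
open Summit.AtomisticToContinuum.Crystallization.Theorems.OverbindingBudgetAffineCompressedCutEstablishTwo (IsSign flipIso flipIso_apply flipLin_apply)
open Summit.AtomisticToContinuum.Crystallization.Theorems.OverbindingBudgetAffineCompressedCutSeed (InLayer lnorm lnorm_nonneg eq_zero_of_lnorm_le
  hex_descent hexL_facts inLayer_tsub inLayer_zero tadd_tadd_tsub tadd_zero_right tadd_zero_left estab_mono hexL_sub)
open Summit.AtomisticToContinuum.Crystallization.Theorems.OverbindingBudgetAffineCompressedCutSeedTwo (seed_fcc seed_hcp estab_normalise_hcp)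
open Summit.AtomisticToContinuum.Crystallization.Theorems.OverbindingBudgetAffineCompressedCutPatch (InBox capv inBox_of_lnorm_le lnorm_le_of_inBox
  inBox_mono tadd_tadd_assoc)
open Summit.AtomisticToContinuum.Crystallization.Theorems.OverbindingBudgetAffineCompressedCutRun (thsum_tadd)
open Summit.AtomisticToContinuum.Crystallization.Theorems.OverbindingBudgetAffineCompressedCutBudget (tauR dR tauR_dR_mono stage_step)
open Summit.AtomisticToContinuum.Crystallization.Theorems.OverbindingBudgetAffineCompressedCutBoxBounds (layer_disc_off_hcp' norm_mv_axis_box_le'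
  inBox_widen room_base_B)

variable {N : ℕ}

/-! ## §1  The hex-disc dichotomy at an fcc base site -/

/-- ★ **HEX-DISC DICHOTOMY (tables KF, no forcing hypothesis).**  Ball data at base `i` (fcc), radius `r`, base frame `ν•A_i`, admissible bound sequences
below `n` and room on the disc of hex radius `n`.  For every `d ≤ n`: EITHER an hcp site has been found at some hex depth `d′ ≤ d` (established, charted onto
a member of `hcpFamilyL`, label a layer vector of `lnorm ≤ 6d′`, bounds `(τs d′, Ds d′)`, window `[0.9967^d′, 1.0011^d′]·ν`) OR every layer vector of
`lnorm ≤ 6d` labels an established `F⁺`-charted site with bounds `(τs d, Ds d)` and window `[0.9967^d, 1.0011^d]·ν`.  Proof: the induction of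
`…Seed.layer_disc` through `hex_descent` and `…Establish.estab_child_one`, keeping the hcp alternative of the child instead of excluding it. [this file] -/
theorem fcc_disc_or_hcp {y : Fin N → EuclideanSpace ℝ (Fin 3)} (hy : Function.Injective y) {r : ℝ} {i : Fin N}
    {A : Fin N → (EuclideanSpace ℝ (Fin 3) →ₗ[ℝ] EuclideanSpace ℝ (Fin 3))} {Qf : Fin N → (EuclideanSpace ℝ (Fin 3) →ₗᵢ[ℝ] EuclideanSpace ℝ (Fin 3))}
    {P : Fin N → Finset (EuclideanSpace ℝ (Fin 3))} {f : Fin N → EuclideanSpace ℝ (Fin 3) → EuclideanSpace ℝ (Fin 3)}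
    (hP : ∀ j, dist (y j) (y i) ≤ r → (P j = fccTwoShellPattern ∨ P j = hcpTwoShellPattern))
    (hA : ∀ j, dist (y j) (y i) ≤ r → ∀ v ∈ P j, ‖A j v - Qf j v‖ ≤ 1 / 1000)
    (hf : ∀ j, dist (y j) (y i) ≤ r → ∀ v ∈ P j, f j v ∈ Set.range y ∧ dist (f j v) (y j + nearestDist y j • A j v) ≤ 1 / 10 ^ 4 * nearestDist y j)
    (hinj : ∀ j, dist (y j) (y i) ≤ r → Set.InjOn (f j) ↑(P j))
    (hex : ∀ j, dist (y j) (y i) ≤ r → ∀ m, m ≠ j → dist (y m) (y j) ≤ (3 / 2 + 1 / 450) * nearestDist y j → ∃ v ∈ P j, f j v = y m)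
    (hr : 0 ≤ r) (hPi : P i = fccTwoShellPattern) {τs Ds : ℕ → ℝ} {n : ℕ} (hτ0 : 0 ≤ τs 0) (hD0 : 0 ≤ Ds 0)
    (hτmono : Monotone τs) (hDmono : Monotone Ds)
    (hτs : ∀ d : ℕ, d + 1 ≤ n → τs d + 5 / 2 * (2 * (1 / 10 ^ 4) * ((10011 / 10000 : ℝ) ^ d * nearestDist y i) +
      1 / 10 ^ 4 * ((10011 / 10000 : ℝ) ^ (d + 1) * nearestDist y i)) ≤ τs (d + 1))
    (hDs : ∀ d : ℕ, d + 1 ≤ n → Ds d + 1 / 10 ^ 4 * ((10011 / 10000 : ℝ) ^ d * nearestDist y i) + τs d ≤ Ds (d + 1))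
    (hroom : ∀ x, InLayer x → lnorm x ≤ 6 * (n : ℤ) → ‖(nearestDist y i • A i) (mv x)‖ + Ds n ≤ r) :
    ∀ d : ℕ, d ≤ n →
      (∃ d' : ℕ, d' ≤ d ∧ ∃ k : Fin N, ∃ M : EuclideanSpace ℝ (Fin 3) →ₗᵢ[ℝ] EuclideanSpace ℝ (Fin 3), ∃ Q : List T3, ∃ x : T3,
        Q ∈ hcpFamilyL ∧ InLayer x ∧ lnorm x ≤ 6 * (d' : ℤ) ∧ dist (y k) (y i) ≤ r ∧
        (9967 / 10000 : ℝ) ^ d' * nearestDist y i ≤ nearestDist y k ∧ nearestDist y k ≤ (10011 / 10000 : ℝ) ^ d' * nearestDist y i ∧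
        Estab y A P (nearestDist y i • A i) i k M Q x (τs d') (Ds d')) ∨
      (∀ x : T3, InLayer x → lnorm x ≤ 6 * (d : ℤ) →
        ∃ k : Fin N, ∃ M : EuclideanSpace ℝ (Fin 3) →ₗᵢ[ℝ] EuclideanSpace ℝ (Fin 3), dist (y k) (y i) ≤ r ∧
          (9967 / 10000 : ℝ) ^ d * nearestDist y i ≤ nearestDist y k ∧ nearestDist y k ≤ (10011 / 10000 : ℝ) ^ d * nearestDist y i ∧
          Estab y A P (nearestDist y i • A i) i k M fccL x (τs d) (Ds d)) := by
  have hi : dist (y i) (y i) ≤ r := by rw [dist_self]; exact hr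
  have hE₀ : Estab y A P (nearestDist y i • A i) i i LinearIsometry.id fccL (0, 0, 0) (τs 0) (Ds 0) := estab_mono (seed_fcc hPi) hτ0 hD0
  have hΛ1 : (1 : ℝ) ≤ 10011 / 10000 := by norm_num
  have hnn₀ : 0 ≤ nearestDist y i := nearestDist_nonneg y i
  have hlf : ∀ Q ∈ [fccL], Q.length ≤ 18 := by decide
  have hlh : ∀ Q ∈ hcpFamilyL, Q.length ≤ 18 := by decide
  intro d
  induction d with
  | zero =>
    intro _
    refine Or.inr fun x _ hl => ?_
    have hx0 : x = (0, 0, 0) := eq_zero_of_lnorm_le x (by simpa using hl)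
    subst hx0
    exact ⟨i, LinearIsometry.id, hi, by simp, by simp, hE₀⟩
  | succ d ih =>
    intro hdn
    have hdn' : d ≤ n := (Nat.le_succ d).trans hdn
    rcases ih hdn' with ⟨d', hd', hrest⟩ | hR
    · exact Or.inl ⟨d', hd'.trans (Nat.le_succ d), hrest⟩
    by_cases hall : ∀ x : T3, InLayer x → lnorm x ≤ 6 * ((d + 1 : ℕ) : ℤ) →
        ∃ k : Fin N, ∃ M : EuclideanSpace ℝ (Fin 3) →ₗᵢ[ℝ] EuclideanSpace ℝ (Fin 3), dist (y k) (y i) ≤ r ∧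
          (9967 / 10000 : ℝ) ^ (d + 1) * nearestDist y i ≤ nearestDist y k ∧ nearestDist y k ≤ (10011 / 10000 : ℝ) ^ (d + 1) * nearestDist y i ∧
          Estab y A P (nearestDist y i • A i) i k M fccL x (τs (d + 1)) (Ds (d + 1))
    · exact Or.inr hall
    push Not at hall
    obtain ⟨x, hx, hl, hnot⟩ := hall
    have hlo_step : (9967 / 10000 : ℝ) ^ (d + 1) * nearestDist y i ≤ (9967 / 10000 : ℝ) ^ d * nearestDist y i :=
      mul_le_mul_of_nonneg_right (pow_le_pow_of_le_one (by norm_num) (by norm_num) (Nat.le_succ d)) hnn₀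
    have hhi_step : (10011 / 10000 : ℝ) ^ d * nearestDist y i ≤ (10011 / 10000 : ℝ) ^ (d + 1) * nearestDist y i :=
      mul_le_mul_of_nonneg_right (pow_le_pow_right₀ hΛ1 (Nat.le_succ d)) hnn₀
    by_cases hl' : lnorm x ≤ 6 * (d : ℤ)
    · obtain ⟨k, M, hkr, hlo, hhi, hE⟩ := hR x hx hl'
      exact absurd (estab_mono hE (hτmono (Nat.le_succ d)) (hDmono (Nat.le_succ d))) (hnot k M hkr (hlo_step.trans hlo) (hhi.trans hhi_step))
    have hne : x ≠ (0, 0, 0) := by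
      rintro rfl
      apply hl'
      simp only [lnorm, abs_zero, add_zero]
      positivity
    obtain ⟨h, hh, hdesc⟩ := hex_descent hx hne
    have hfacts := hexL_facts h hh
    have hx'L : InLayer (tsub x h) := inLayer_tsub hx hfacts.1
    have hcast : ((d + 1 : ℕ) : ℤ) = (d : ℤ) + 1 := by push_cast; ring
    have hl'' : lnorm (tsub x h) ≤ 6 * (d : ℤ) := by rw [hcast] at hl; linarith
    obtain ⟨p, Mp, hpr, hplo, hphi, hEp⟩ := hR (tsub x h) hx'L hl''
    have hdnZ : ((d + 1 : ℕ) : ℤ) ≤ (n : ℤ) := by exact_mod_cast hdn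
    have hroomx := hroom x hx (hl.trans (by linarith))
    have hDn : Ds (d + 1) ≤ Ds n := hDmono hdn
    have h2p : 1 / 10 ^ 4 * nearestDist y p ≤ 1 / 10 ^ 4 * ((10011 / 10000 : ℝ) ^ d * nearestDist y i) :=
      mul_le_mul_of_nonneg_left hphi (by norm_num)
    have hDstep := hDs d hdn
    have hball : ‖(nearestDist y i • A i) (mv (tadd (tadd (0, 0, 0) (tsub x h)) h))‖ + (Ds d + 1 / 10 ^ 4 * nearestDist y p + τs d) ≤ r := by
      rw [tadd_tadd_tsub, tadd_zero_left]
      linarith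
    have hEp' : Estab y A P (nearestDist y i • A i) i p Mp fccL (tadd (0, 0, 0) (tsub x h)) (τs d) (Ds d) := by
      rw [tadd_zero_left]; exact hEp
    obtain ⟨k, v, -, -, -, -, hkr, hsc, hsc', R₁, -, Q, hQ, hEk⟩ :=
      estab_child_one hy hP hA hf hinj hex hpr hEp' (hexL_sub.2.2.1 h hh) hfacts.2 (hexL_sub.2.2.2.2 h hh) kf_fcc kf_hcp hlf hlh hball
    rw [tadd_tadd_tsub, tadd_zero_left] at hEk
    have hkhi : nearestDist y k ≤ (10011 / 10000 : ℝ) ^ (d + 1) * nearestDist y i := by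
      have h1 : 10011 / 10000 * nearestDist y p ≤ 10011 / 10000 * ((10011 / 10000 : ℝ) ^ d * nearestDist y i) :=
        mul_le_mul_of_nonneg_left hphi (by norm_num)
      have e : 10011 / 10000 * ((10011 / 10000 : ℝ) ^ d * nearestDist y i) = (10011 / 10000 : ℝ) ^ (d + 1) * nearestDist y i := by
        rw [pow_succ]; ring
      linarith
    have hklo : (9967 / 10000 : ℝ) ^ (d + 1) * nearestDist y i ≤ nearestDist y k := by
      have h1 : 9967 / 10000 * ((9967 / 10000 : ℝ) ^ d * nearestDist y i) ≤ 9967 / 10000 * nearestDist y p :=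
        mul_le_mul_of_nonneg_left hplo (by norm_num)
      have e : 9967 / 10000 * ((9967 / 10000 : ℝ) ^ d * nearestDist y i) = (9967 / 10000 : ℝ) ^ (d + 1) * nearestDist y i := by
        rw [pow_succ]; ring
      linarith
    have hτle : τs d + 5 / 2 * (2 * (1 / 10 ^ 4) * nearestDist y p + 1 / 10 ^ 4 * nearestDist y k) ≤ τs (d + 1) := by
      have h1 := hτs d hdn
      have h2 : 2 * (1 / 10 ^ 4) * nearestDist y p ≤ 2 * (1 / 10 ^ 4) * ((10011 / 10000 : ℝ) ^ d * nearestDist y i) :=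
        mul_le_mul_of_nonneg_left hphi (by norm_num)
      have h3 : 1 / 10 ^ 4 * nearestDist y k ≤ 1 / 10 ^ 4 * ((10011 / 10000 : ℝ) ^ (d + 1) * nearestDist y i) :=
        mul_le_mul_of_nonneg_left hkhi (by norm_num)
      linarith
    have hDle : Ds d + 1 / 10 ^ 4 * nearestDist y p + τs d ≤ Ds (d + 1) := by linarith
    have hEk' := estab_mono hEk hτle hDle
    rcases hQ with ⟨-, hQf⟩ | ⟨-, hQh⟩
    · rw [List.mem_singleton] at hQf
      rw [hQf] at hEk'
      exact absurd hEk' (hnot k (Mp.comp R₁) hkr hklo hkhi)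
    · exact Or.inl ⟨d + 1, le_rfl, k, Mp.comp R₁, Q, x, hQh, hx, hl, hkr, hklo, hkhi, hEk'⟩

/-! ## §2  Case A label arithmetic — a finite certified table -/

/-- The axis offset of residue `r (mod 3)`: `0`, `(1,1,−2)` or `(−1,−1,2)`. [this file] -/
def wOf (r : ℤ) : T3 := if r % 3 = 0 then (0, 0, 0) else if r % 3 = 1 then (1, 1, -2) else (-1, -1, 2)

/-- Facts about `wOf r`: in the box `2`, sum zero, equal first two coordinates, constant residue, and `w₁ ≡ r (mod 3)`. [this file] -/
theorem wOf_facts (r : ℤ) : InBox (0, 0, 0) 2 (wOf r) ∧ thsum (wOf r) = 0 ∧ (wOf r).1 = (wOf r).2.1 ∧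
    (3 : ℤ) ∣ ((wOf r).2.1 - (wOf r).2.2) ∧ (3 : ℤ) ∣ ((wOf r).1 - r) := by
  unfold wOf
  split_ifs with h0 h1
  · refine ⟨⟨by simp, by simp, by simp⟩, by simp [thsum], rfl, by simp, ?_⟩
    simp only [zero_sub, dvd_neg]; omega
  · refine ⟨⟨by simp, by simp, by simp⟩, by simp [thsum], rfl, by norm_num, ?_⟩
    omega
  · refine ⟨⟨by simp, by simp, by simp⟩, by simp [thsum], rfl, by norm_num, ?_⟩
    omega

/-- The eight coordinate sign patterns. [this file] -/
def signsL : List T3 := [(1, 1, 1), (1, 1, -1), (1, -1, 1), (-1, 1, 1), (1, -1, -1), (-1, 1, -1), (-1, -1, 1), (-1, -1, -1)]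

/-- A sign vector is one of the eight. [this file] -/
theorem mem_signsL {s : T3} (hs : IsSign s) : s ∈ signsL := by
  obtain ⟨s₁, s₂, s₃⟩ := s
  obtain ⟨h1, h2, h3⟩ := hs
  dsimp only at h1 h2 h3
  rcases h1 with rfl | rfl <;> rcases h2 with rfl | rfl <;> rcases h3 with rfl | rfl <;> simp [signsL]

/-- The integers of absolute value `≤ 6`. [this file] -/
def I6 : List ℤ := [-6, -5, -4, -3, -2, -1, 0, 1, 2, 3, 4, 5, 6]

/-- Membership in `I6`. [this file] -/
theorem mem_I6 {a : ℤ} (h : |a| ≤ 6) : a ∈ I6 := by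
  rw [abs_le] at h
  simp only [I6, List.mem_cons, List.not_mem_nil, or_false]
  omega

/-- The Case A seed label after the flip `Φ_s`: `λ₀ = tflip s (3a, 3b, −3(a+b))`. [this file] -/
def lamA (s : T3) (a b : ℤ) : T3 := tflip s (3 * a, 3 * b, 3 * (-(a + b)))

/-- Its level `j = thsum λ₀ / 6`. [this file] -/
def levA (s : T3) (a b : ℤ) : ℤ := thsum (lamA s a b) / 6

/-- The in-layer remainder `x₀ = λ₀ − ((2j,2j,2j) + wOf j)`. [this file] -/
def remA (s : T3) (a b : ℤ) : T3 := tsub (lamA s a b) (tadd (2 * levA s a b, 2 * levA s a b, 2 * levA s a b) (wOf (levA s a b)))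

/-- ★ **THE CASE A TABLE** (`decide` over the `8 × 13 × 13` cases): for every sign pattern `s` and every layer vector `x′ = 3(a, b, −a−b)` with
`S = |a| + |b| + |a+b| ≤ 12` (`lnorm x′ = 3S ≤ 36`): `thsum λ₀ = 6j`, `x₀` is a layer vector, `lnorm x₀ = 6h₀` with `2h₀ ≤ S`, `2h₀ + 2|j| ≤ S + 8` and
`2|j| ≤ S` (`λ₀ = lamA`, `j = levA`, `x₀ = remA`). [this file] -/
theorem caseA_table : ∀ s ∈ signsL, ∀ a ∈ I6, ∀ b ∈ I6, |a| + |b| + |a + b| ≤ 12 →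
    thsum (lamA s a b) = 6 * levA s a b ∧
    ((remA s a b).1 + (remA s a b).2.1 + (remA s a b).2.2 = 0 ∧ (3 : ℤ) ∣ (remA s a b).1 ∧ (3 : ℤ) ∣ (remA s a b).2.1) ∧
    lnorm (remA s a b) = 6 * (lnorm (remA s a b) / 6) ∧
    2 * (lnorm (remA s a b) / 6) ≤ |a| + |b| + |a + b| ∧
    2 * (lnorm (remA s a b) / 6) + 2 * |levA s a b| ≤ |a| + |b| + |a + b| + 8 ∧
    2 * |levA s a b| ≤ |a| + |b| + |a + b| := by
  decide

/-- ★ **CASE A SPLIT.**  For a layer vector `x′` of `lnorm ≤ 6d′` (`d′ ≤ 6`) and a sign `s`: `tflip s x′ = ((2j,2j,2j) + w) + x₀` with `w` in the box `2`,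
sum zero and of constant residue, `x₀` a layer vector with `lnorm x₀ ≤ 6h₀`, and the budget `h₀ ≤ d′`, `h₀ + |j| ≤ d′ + 4`, `|j| ≤ d′`. [this file] -/
theorem caseA_split {x' : T3} (hx' : InLayer x') {d' : ℕ} (hl : lnorm x' ≤ 6 * (d' : ℤ)) (hd' : d' ≤ 6) {s : T3} (hs : IsSign s) :
    ∃ (j : ℤ) (w x₀ : T3) (h₀ : ℕ), tflip s x' = tadd (tadd (2 * j, 2 * j, 2 * j) w) x₀ ∧ InBox (0, 0, 0) 2 w ∧ thsum w = 0 ∧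
      w.1 = w.2.1 ∧ (3 : ℤ) ∣ (w.2.1 - w.2.2) ∧ InLayer x₀ ∧ lnorm x₀ ≤ 6 * (h₀ : ℤ) ∧ h₀ ≤ d' ∧ (h₀ : ℤ) + |j| ≤ d' + 4 ∧ |j| ≤ d' := by
  obtain ⟨x₁, x₂, x₃⟩ := x'
  obtain ⟨hs0, ⟨a, ha⟩, ⟨b, hb⟩⟩ := hx'
  dsimp only at hs0 ha hb
  have hc : x₃ = 3 * (-(a + b)) := by linarith
  subst ha; subst hb; subst hc
  have hS : 3 * (|a| + |b| + |a + b|) ≤ 6 * (d' : ℤ) := by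
    have e : lnorm ((3 * a, 3 * b, 3 * (-(a + b))) : T3) = 3 * (|a| + |b| + |a + b|) := by
      simp only [lnorm, abs_mul, abs_neg, abs_of_pos (by norm_num : (0 : ℤ) < 3)]; ring
    linarith
  have hd6 : (d' : ℤ) ≤ 6 := by exact_mod_cast hd'
  have hab : |a| ≤ |a + b| + |b| := by
    have := abs_sub (a + b) b; simp only [add_sub_cancel_right] at this; exact this
  have hba : |b| ≤ |a + b| + |a| := by
    have := abs_sub (a + b) a; simp only [add_sub_cancel_left] at this; exact this
  have haI : a ∈ I6 := mem_I6 (by linarith [abs_nonneg b, abs_nonneg (a + b)])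
  have hbI : b ∈ I6 := mem_I6 (by linarith [abs_nonneg a, abs_nonneg (a + b)])
  obtain ⟨-, hL, hln, h1, h2, h3⟩ := caseA_table s (mem_signsL hs) a haI b hbI (by linarith)
  obtain ⟨hwb, hw0, hw12, hw23, -⟩ := wOf_facts (levA s a b)
  have hln0 : 0 ≤ lnorm (remA s a b) / 6 := Int.ediv_nonneg (lnorm_nonneg _) (by norm_num)
  refine ⟨levA s a b, wOf (levA s a b), remA s a b, (lnorm (remA s a b) / 6).toNat, ?_, hwb, hw0, hw12, hw23, hL, ?_, ?_, ?_, ?_⟩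
  · simp only [remA, lamA, tadd_tsub_cancel]
  · rw [Int.toNat_of_nonneg hln0]; exact hln.le
  · have : ((lnorm (remA s a b) / 6).toNat : ℤ) ≤ (d' : ℤ) := by rw [Int.toNat_of_nonneg hln0]; linarith
    exact_mod_cast this
  · rw [Int.toNat_of_nonneg hln0]; linarith
  · linarith

/-! ## §3  Room for the Case A base at depth `≤ 21`, `H ∈ hcpFamilyL` -/

/-- Room number for the Case A base at `a + dm ≤ 21`: `(401/400)·√(12²/6 + 29²/9) + D₂₁ ≤ 12` (`10.864 + 0.166`). [this file] -/
theorem room_budget21 {ν : ℝ} (hν : 0 < ν) : 401 / 400 * ν * Real.sqrt ((12 : ℝ) ^ 2 / 6 + (29 : ℝ) ^ 2 / 9) + dR ν 21 ≤ 12 * ν := by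
  have q1 : Real.sqrt ((12 : ℝ) ^ 2 / 6 + (29 : ℝ) ^ 2 / 9) ≤ 10838 / 1000 := by
    rw [Real.sqrt_le_left (by norm_num)]; norm_num
  simp only [dR]
  push_cast
  nlinarith [mul_le_mul_of_nonneg_left q1 (by positivity : (0 : ℝ) ≤ 401 / 400 * ν)]

/-- ★ **ROOM, Case A base at depth `≤ 21`** (the `hroom` of `layer_disc_off_hcp'`, `n = 9`, centre label `(k₀,k₀,k₀) + w`, `|k₀| ≤ 12`, `|w_c| ≤ 2`). [this file] -/
theorem room_base_A21 {ν : ℝ} (hν : 0 < ν) {B : EuclideanSpace ℝ (Fin 3) →ₗ[ℝ] EuclideanSpace ℝ (Fin 3)} (hBup : ∀ z, ‖B z‖ ≤ 401 / 400 * ν * ‖z‖)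
    {k₀ : ℤ} {w : T3} (hw : InBox (0, 0, 0) 2 w) (hw0 : thsum w = 0) (hk : |k₀| ≤ 12) {a dm : ℕ} (h21 : a + dm ≤ 21) :
    ∀ x, InLayer x → lnorm x ≤ 6 * 9 → ‖B (mv (tadd (tadd (k₀, k₀, k₀) w) x))‖ + dR ν (a + dm) ≤ 12 * ν := by
  intro x hx hl
  rw [tadd_tadd_assoc]
  have hwt : thsum (tadd w x) = 0 := by rw [thsum_tadd, hw0, show thsum x = 0 from hx.1]; norm_num
  have hn := norm_mv_axis_box_le' hwt (inBox_widen hw (inBox_of_lnorm_le hx hl)) hk (by norm_num) (by norm_num : (3 * 9 : ℤ) + 2 ≤ 29)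
  have hR := room_budget21 hν
  obtain ⟨-, -, -, e3⟩ := tauR_dR_mono hν.le h21
  nlinarith [hBup (mv (tadd (k₀, k₀, k₀) (tadd w x))), mul_le_mul_of_nonneg_left hn (by positivity : (0 : ℝ) ≤ 401 / 400 * ν)]

/-- `H` itself is a member of `hcpFamilyL` (the identity flip). [this file] -/
theorem hcpL_mem_hcpFamilyL : hcpL ∈ hcpFamilyL := by decide

/-- The identity flip: `Φ₍₁,₁,₁₎ = id`. [this file] -/
theorem flipIso_one (h : IsSign ((1 : ℤ), (1 : ℤ), (1 : ℤ))) (z : EuclideanSpace ℝ (Fin 3)) : flipIso (1, 1, 1) h z = z := by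
  ext t
  rw [flipIso_apply, flipLin_apply]
  fin_cases t <;> simp [toV]

/-! ## §4  The base patch at the record constants -/

/-- The upper frame bound survives a flip. [this file] -/
theorem upper_flip {ν : ℝ} {B : EuclideanSpace ℝ (Fin 3) →ₗ[ℝ] EuclideanSpace ℝ (Fin 3)} (hBup : ∀ z, ‖B z‖ ≤ 401 / 400 * ν * ‖z‖) {s : T3}
    (hs : IsSign s) : ∀ z, ‖(B ∘ₗ (flipIso s hs).toLinearMap) z‖ ≤ 401 / 400 * ν * ‖z‖ := by
  intro z
  rw [LinearMap.comp_apply, LinearIsometry.coe_toLinearMap]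
  have h := hBup (flipIso s hs z)
  rwa [LinearIsometry.norm_map] at h

/-- `(1,1,1)` is a sign vector. [this file] -/
theorem isSign_one : IsSign ((1 : ℤ), (1 : ℤ), (1 : ℤ)) := ⟨Or.inl rfl, Or.inl rfl, Or.inl rfl⟩

/-- Composing with the identity flip does nothing. [this file] -/
theorem comp_flipIso_one (B : EuclideanSpace ℝ (Fin 3) →ₗ[ℝ] EuclideanSpace ℝ (Fin 3)) (h : IsSign ((1 : ℤ), (1 : ℤ), (1 : ℤ))) :
    B ∘ₗ (flipIso (1, 1, 1) h).toLinearMap = B := by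
  apply LinearMap.ext
  intro z
  rw [LinearMap.comp_apply, LinearIsometry.coe_toLinearMap, flipIso_one]

/-- ★★ **THE BASE PATCH AT THE RECORD CONSTANTS** (the `hbase` of «BoxBounds».`stack_run_box_record`, both cases in one shape).  From the record ball data
at `i` (radius `12ν`, `ν = nn_i`, base frame upper bound `401/400`): a sign `s`, an aligned copy `C₀ ∈ {F⁺, F⁻, H, H′}`, a level `j` (`|j| ≤ 6`), an axis
offset `w` (`|w_c| ≤ bw ≤ 2`, sum `0`, constant residue), a box `18 ≤ K₀ ≤ 27` with the COVERAGE INEQUALITY `18 − |ℓ| + bw ≤ K₀ − |ℓ − j|` (`|ℓ| ≤ 5`) and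
a step count `a` with `a + 5 + |j| ≤ 31`, such that in the flipped frame `(ν•A_i) ∘ Φ_s` every layer vector of the box `K₀` labels, at
`(2j,2j,2j) + w + x`, an established site with copy `C₀`, bounds `(tauR ν a, dR ν a)` and window `[0.9967^a, 1.0011^a]·ν`.  CASE B (the fcc hex disc of
radius `6` closes): `s = (1,1,1)`, `C₀ = F⁺`, `j = 0`, `w = 0`, `bw = 0`, `K₀ = 18`, `a = 6`.  CASE A (an hcp site `k₀` at hex depth `d′ ≤ 6`, or `i` itself
hcp with `d′ = 0`): O8-normalise its chart (`estab_normalise_hcp`), split its label (`caseA_split`), grow its layer disc of hex radius `9` off-centre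
(`layer_disc_off_hcp'`, `dm = 9 + h₀`, depth `d′ + dm ≤ 21`, room `room_base_A21`): `K₀ = 27`, `bw = 2`, `a = d′ + 9 + h₀`. [this file] -/
theorem base_patch_record {y : Fin N → EuclideanSpace ℝ (Fin 3)} (hy : Function.Injective y) {i : Fin N}
    {A : Fin N → (EuclideanSpace ℝ (Fin 3) →ₗ[ℝ] EuclideanSpace ℝ (Fin 3))} {Qf : Fin N → (EuclideanSpace ℝ (Fin 3) →ₗᵢ[ℝ] EuclideanSpace ℝ (Fin 3))}
    {P : Fin N → Finset (EuclideanSpace ℝ (Fin 3))} {f : Fin N → EuclideanSpace ℝ (Fin 3) → EuclideanSpace ℝ (Fin 3)}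
    (hP : ∀ j, dist (y j) (y i) ≤ 12 * nearestDist y i → (P j = fccTwoShellPattern ∨ P j = hcpTwoShellPattern))
    (hA : ∀ j, dist (y j) (y i) ≤ 12 * nearestDist y i → ∀ v ∈ P j, ‖A j v - Qf j v‖ ≤ 1 / 1000)
    (hf : ∀ j, dist (y j) (y i) ≤ 12 * nearestDist y i → ∀ v ∈ P j, f j v ∈ Set.range y ∧
      dist (f j v) (y j + nearestDist y j • A j v) ≤ 1 / 10 ^ 4 * nearestDist y j)
    (hinj : ∀ j, dist (y j) (y i) ≤ 12 * nearestDist y i → Set.InjOn (f j) ↑(P j))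
    (hex : ∀ j, dist (y j) (y i) ≤ 12 * nearestDist y i → ∀ m, m ≠ j → dist (y m) (y j) ≤ (3 / 2 + 1 / 450) * nearestDist y j →
      ∃ v ∈ P j, f j v = y m)
    (hν : 0 < nearestDist y i) (hBup : ∀ z, ‖(nearestDist y i • A i) z‖ ≤ 401 / 400 * nearestDist y i * ‖z‖) :
    ∃ (s : T3) (hs : IsSign s) (C₀ : List T3) (j : ℤ) (w : T3) (bw K₀ : ℤ) (a : ℕ),
      (C₀ = fccL ∨ C₀ = fccNegL ∨ C₀ = hcpL ∨ C₀ = hcpAltL) ∧ |j| ≤ 6 ∧ InBox (0, 0, 0) bw w ∧ 0 ≤ bw ∧ bw ≤ 2 ∧ thsum w = 0 ∧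
      w.1 = w.2.1 ∧ (3 : ℤ) ∣ (w.2.1 - w.2.2) ∧ K₀ ≤ 27 ∧ 18 ≤ K₀ ∧ (∀ ℓ : ℤ, |ℓ| ≤ 5 → 18 - |ℓ| + bw ≤ K₀ - |ℓ - j|) ∧
      (a : ℤ) + 5 + |j| ≤ 31 ∧
      ∀ x : T3, InLayer x → InBox (0, 0, 0) K₀ x →
        ∃ k : Fin N, ∃ M : EuclideanSpace ℝ (Fin 3) →ₗᵢ[ℝ] EuclideanSpace ℝ (Fin 3), dist (y k) (y i) ≤ 12 * nearestDist y i ∧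
          (9967 / 10000 : ℝ) ^ a * nearestDist y i ≤ nearestDist y k ∧ nearestDist y k ≤ (10011 / 10000 : ℝ) ^ a * nearestDist y i ∧
          Estab y A P ((nearestDist y i • A i) ∘ₗ (flipIso s hs).toLinearMap) i k M C₀ (tadd (tadd (2 * j, 2 * j, 2 * j) w) x)
            (tauR (nearestDist y i) a) (dR (nearestDist y i) a) := by
  set ν := nearestDist y i with hνdef
  have hr : (0 : ℝ) ≤ 12 * ν := by positivity
  have hi : dist (y i) (y i) ≤ 12 * ν := by rw [dist_self]; exact hr
  obtain ⟨hτm, hDm, hτs, hDs⟩ := stage_step hν.le (a := 0) (n := 6) (ν_s := ν) (by simp) (by norm_num)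
  simp only [Nat.zero_add] at hτm hDm hτs hDs
  have hτ0 : (0 : ℝ) ≤ tauR ν 0 := by simp [tauR]
  have hD0 : (0 : ℝ) ≤ dR ν 0 := by simp [dR]
  have hroom : ∀ x, InLayer x → lnorm x ≤ 6 * ((6 : ℕ) : ℤ) → ‖(ν • A i) (mv x)‖ + dR ν 6 ≤ 12 * ν :=
    fun x hx hl => room_base_B hν hBup (n := 6) (by norm_num) x hx (by simpa using hl)
  have hAB : (∃ d' : ℕ, d' ≤ 6 ∧ ∃ k : Fin N, ∃ M : EuclideanSpace ℝ (Fin 3) →ₗᵢ[ℝ] EuclideanSpace ℝ (Fin 3), ∃ Q : List T3, ∃ x : T3,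
        Q ∈ hcpFamilyL ∧ InLayer x ∧ lnorm x ≤ 6 * (d' : ℤ) ∧ dist (y k) (y i) ≤ 12 * ν ∧
        (9967 / 10000 : ℝ) ^ d' * ν ≤ nearestDist y k ∧ nearestDist y k ≤ (10011 / 10000 : ℝ) ^ d' * ν ∧
        Estab y A P (ν • A i) i k M Q x (tauR ν d') (dR ν d')) ∨
      (∀ x : T3, InLayer x → lnorm x ≤ 6 * ((6 : ℕ) : ℤ) →
        ∃ k : Fin N, ∃ M : EuclideanSpace ℝ (Fin 3) →ₗᵢ[ℝ] EuclideanSpace ℝ (Fin 3), dist (y k) (y i) ≤ 12 * ν ∧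
          (9967 / 10000 : ℝ) ^ 6 * ν ≤ nearestDist y k ∧ nearestDist y k ≤ (10011 / 10000 : ℝ) ^ 6 * ν ∧
          Estab y A P (ν • A i) i k M fccL x (tauR ν 6) (dR ν 6)) := by
    rcases hP i hi with hPi | hPi
    · exact fcc_disc_or_hcp hy hP hA hf hinj hex hr hPi (τs := fun d => tauR ν d) (Ds := fun d => dR ν d) (n := 6) hτ0 hD0 hτm hDm hτs hDs
        hroom 6 le_rfl
    · exact Or.inl ⟨0, by norm_num, i, LinearIsometry.id, hcpL, (0, 0, 0), hcpL_mem_hcpFamilyL, inLayer_zero, by simp [lnorm], hi,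
        by simp [hνdef], by simp [hνdef], estab_mono (seed_hcp hPi) hτ0 hD0⟩
  rcases hAB with ⟨d', hd', k₀, M, Q, x', hQ, hx', hl', hk₀r, hlo, hhi, hE⟩ | hB
  · obtain ⟨s, hs, C', hC', hE'⟩ := estab_normalise_hcp hQ hE
    obtain ⟨j, w, x₀, h₀, hsplit, hwb, hw0, hw12, hw23, hx₀, hx₀l, hh₀d, hjoint, hjd⟩ := caseA_split hx' hl' hd' hs
    rw [hsplit] at hE'
    have hBup' := upper_flip hBup hs
    have hd6 : (d' : ℤ) ≤ 6 := by exact_mod_cast hd'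
    have hh₀Z : (h₀ : ℤ) ≤ d' := by exact_mod_cast hh₀d
    have hj6 : |j| ≤ 6 := hjd.trans hd6
    have hk : |2 * j| ≤ 12 := by rw [abs_mul, abs_two]; linarith
    obtain ⟨hτm', hDm', hτs', hDs'⟩ := stage_step hν.le (a := d') (n := 9 + h₀) (ν_s := nearestDist y k₀) hhi (by omega)
    have hreach : 6 * ((9 : ℕ) : ℤ) + lnorm x₀ ≤ 6 * ((9 + h₀ : ℕ) : ℤ) := by push_cast; linarith
    have hx₀b : lnorm x₀ ≤ 6 * ((9 : ℕ) : ℤ) := by push_cast; linarith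
    have hroomA : ∀ x, InLayer x → lnorm x ≤ 6 * ((9 : ℕ) : ℤ) →
        ‖((ν • A i) ∘ₗ (flipIso s hs).toLinearMap) (mv (tadd (tadd (2 * j, 2 * j, 2 * j) w) x))‖ + dR ν (d' + (9 + h₀)) ≤ 12 * ν :=
      fun x hx hl => room_base_A21 hν hBup' hwb hw0 hk (a := d') (dm := 9 + h₀) (by omega) x hx (by simpa using hl)
    have hgrow := layer_disc_off_hcp' hy hP hA hf hinj hex hC' (τs := fun d => tauR ν (d' + d)) (Ds := fun d => dR ν (d' + d)) (n := 9)
      (dm := 9 + h₀) hreach hx₀ hx₀b hk₀r hE' hτm' hDm' hτs' hDs' hroomA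
    have hhi0 : (0 : ℝ) ≤ (10011 / 10000 : ℝ) ^ (9 + h₀) := by positivity
    have hlo0 : (0 : ℝ) ≤ (9967 / 10000 : ℝ) ^ (9 + h₀) := by positivity
    refine ⟨s, hs, C', j, w, 2, 27, d' + (9 + h₀), ?_, hj6, hwb, by norm_num, le_rfl, hw0, hw12, hw23, le_rfl, by norm_num, ?_, ?_, ?_⟩
    · rcases hC' with rfl | rfl <;> simp
    · intro ℓ _
      have := abs_sub ℓ j
      linarith
    · push_cast; linarith
    · intro x hx hbox
      obtain ⟨k, Mk, hkr, hklo, hkhi, hEk⟩ := hgrow x hx (by simpa using hbox)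
      refine ⟨k, Mk, hkr, ?_, ?_, hEk⟩
      · calc (9967 / 10000 : ℝ) ^ (d' + (9 + h₀)) * ν = (9967 / 10000 : ℝ) ^ (9 + h₀) * ((9967 / 10000 : ℝ) ^ d' * ν) := by rw [pow_add]; ring
          _ ≤ (9967 / 10000 : ℝ) ^ (9 + h₀) * nearestDist y k₀ := mul_le_mul_of_nonneg_left hlo hlo0
          _ ≤ nearestDist y k := hklo
      · calc nearestDist y k ≤ (10011 / 10000 : ℝ) ^ (9 + h₀) * nearestDist y k₀ := hkhi
          _ ≤ (10011 / 10000 : ℝ) ^ (9 + h₀) * ((10011 / 10000 : ℝ) ^ d' * ν) := mul_le_mul_of_nonneg_left hhi hhi0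
          _ = (10011 / 10000 : ℝ) ^ (d' + (9 + h₀)) * ν := by rw [pow_add]; ring
  · refine ⟨(1, 1, 1), isSign_one, fccL, 0, (0, 0, 0), 0, 18, 6, by simp, by norm_num, ⟨by simp, by simp, by simp⟩, le_rfl, by norm_num,
      by simp [thsum], rfl, by simp, by norm_num, le_rfl, ?_, by norm_num, ?_⟩
    · intro ℓ _; simp
    · intro x hx hbox
      obtain ⟨k, Mk, hkr, hklo, hkhi, hEk⟩ := hB x hx (by simpa using lnorm_le_of_inBox hx (inBox_mono hbox (by norm_num : (18 : ℤ) ≤ 3 * 6)))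
      refine ⟨k, Mk, hkr, hklo, hkhi, ?_⟩
      rw [comp_flipIso_one, show (((2 : ℤ) * 0, (2 : ℤ) * 0, (2 : ℤ) * 0) : T3) = (0, 0, 0) by norm_num, tadd_zero_left, tadd_zero_left]
      exact hEk

end Summit.AtomisticToContinuum.Crystallization.Theorems.OverbindingBudgetAffineCompressedCutStepA
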